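import Summits.QuantumAdvantage.AdviceFreeQNC0.CounterStrategies
import Summits.QuantumAdvantage.AdviceFreeQNC0.AffBells22SubcubeWalk
import HarnessLib

/-!
# Counter strategies on SUBCUBES — RUNG R13 conditioned on frozen bits (decomp-qadv lens-6 g13, tree part 22 = the «SliceDial» §31 rung, PROVED)

`WalkHardFCounterSubcubeSharp p` / `WalkHardFCounterSubcube p`: R13 (`CounterStrategies.walkHardFCounterSharp`) for the
walk game RESTRICTED TO A SUBCUBE `{u : u_W = b_W}`: a strategy whose cut `g` reads the (merged) input only through
`W_{<g} mod p` ON THE SUBCUBE wins on at most `(2/3 + 2p·√(12p/(m+1)))·2ⁿ` of the merged inputs `subcubeMerge W b u`,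
`u ∈ {0,1}ⁿ` (each subcube point counted `2^{|W|}` times), where `m = n − |W|` is the number of FREE positions; hence
`≤ (5/6)·2ⁿ` once `m ≥ 1728 p³` (`3 ∤ p`).  PROOF = p2's six lines (`CounterStrategies`) with one change: at a FROZEN
position the bit step of the law is a deterministic bijection of `St p` (`lawS_succ_frozen`), which preserves `Q`
(`Q_lawS_succ_frozen`) and `Φ` (`phi_comp_bitEq_symm`); the `L²` budget and the good time run over the FREE steps only
(`sum_D2_free_le`, `exists_D1_le_free`).  Subcube-measurable strategies are first replaced by GLOBAL counter strategies
agreeing with them on the subcube (`exists_global`), so the trajectory lemmas of `CounterProcess` apply verbatim to the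
merged inputs.  THEOREMS: `walkHardFCounterSubcubeSharp`, `walkHardFCounterSubcube` (both Props kernel-closed),
`counterSubcubeHard_of_prime` (prime `p ≠ 3`, the exact shape of the annex's `CounterSubcubeHard p`), `walkHardFCounter_of_subcube`
(`W = ∅` recovers `WalkHardFCounter p`).  Used by the «SliceDial» annex (rev 17, §32 ≡ this file's body): `CounterSubcubeHard p` ⇒
`UnreadBitsHard p` ⇒ `PrefixFormHard p ⟺ PrefixCoreHard p` UNCONDITIONALLY for every prime `p ≥ 5` — the open prefix face of
CharDial's item is its time-dense ∧ read-covered core.  WHAT THIS IS NOT: juntas are not covered here (they enter only through the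
conditioning in the annex's `unreadBitsHard_of_counterSubcube`); the rate is `m^{-1/2}` in the number of free positions.
-/

namespace Summit.QuantumAdvantage.AdviceFreeQNC0

open Finset AffBells22

/-! ## §1 Statements -/

/-- R13 on subcubes, SHARP form: for `3 ∤ p`, on the subcube `{u_W = b_W}` every strategy reading the merged input only
through `W_{<g} mod p` wins on at most `(2/3 + 2p√(12p/(n − |W| + 1)))·2ⁿ` merged inputs. -/
def WalkHardFCounterSubcubeSharp (p : ℕ) : Prop :=
  ¬ 3 ∣ p → 0 < p → ∀ (n c : ℕ) (W : Finset (Fin n)) (b : Fin n → Bool) (y : Fin (n + 1) → (Fin n → Bool) → Bool),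
    (∀ g : Fin (n + 1), ∀ u v : Fin n → Bool,
        wtPrefix (subcubeMerge W b u) g.val % p = wtPrefix (subcubeMerge W b v) g.val % p →
          y g (subcubeMerge W b u) = y g (subcubeMerge W b v)) →
      ((univ.filter fun u : Fin n → Bool => ringWinU c y (subcubeMerge W b u) = true).card : ℝ)
        ≤ (2 / 3 + 2 * p * Real.sqrt (12 * p / ((n - W.card : ℕ) + 1))) * (2 : ℝ) ^ n

/-- R13 on subcubes, rung form (`θ`, `m₀` uniform in `n`, `W`, `b`) for `3 ∤ p`, `0 < p`: after the two hypotheses the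
body is VERBATIM the annex's `CounterSubcubeHard p` («SliceDial» §31). -/
def WalkHardFCounterSubcube (p : ℕ) : Prop :=
  ¬ 3 ∣ p → 0 < p → ∃ θ : ℝ, θ < 1 ∧ ∃ m₀ : ℕ, ∀ (n c : ℕ) (W : Finset (Fin n)) (b : Fin n → Bool)
    (y : Fin (n + 1) → (Fin n → Bool) → Bool), m₀ + W.card ≤ n →
    (∀ g : Fin (n + 1), ∀ u v : Fin n → Bool,
        wtPrefix (subcubeMerge W b u) g.val % p = wtPrefix (subcubeMerge W b v) g.val % p →
          y g (subcubeMerge W b u) = y g (subcubeMerge W b v)) →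
      ((univ.filter fun u : Fin n → Bool => ringWinU c y (subcubeMerge W b u) = true).card : ℝ) ≤ θ * (2 : ℝ) ^ n

namespace CounterLaw

/-! ## §2 `Φ` is invariant under the label/counter shifts (the frozen bit step) -/

section Shift

variable (p : ℕ) [NeZero p]

/-- `Φ` is invariant under `(g, a, b) ↦ (g, a − k, b − j)`. -/
theorem phi_shift_eq (μ : St p → ℝ) (k : ZMod 3) (j : ZMod p) :
    phi (fun x : St p => μ (x.1, x.2.1 - k, x.2.2 - j)) = phi μ := by
  unfold phi
  have hm : ∀ i b', mass (fun x : St p => μ (x.1, x.2.1 - k, x.2.2 - j)) i b' = mass μ (shEquiv k i) (b' - j) := by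
    intro i b'
    show _ = mass μ (shIdx k i) (b' - j)
    rw [← mass_shift μ k i (b' - j)]
    simp only [mass]
  simp only [hm]
  rw [show (∑ b' : ZMod p, (univ : Finset Idx).inf' ⟨(0, none), mem_univ _⟩ fun i => mass μ (shEquiv k i) (b' - j))
      = ∑ b' : ZMod p, (univ : Finset Idx).inf' ⟨(0, none), mem_univ _⟩ fun i => mass μ i (b' - j) from
    sum_congr rfl fun b' _ => inf'_comp_equiv _ (shEquiv k) (fun i => mass μ i (b' - j))]
  exact Equiv.sum_comp (Equiv.subRight j) (fun b' => (univ : Finset Idx).inf' ⟨(0, none), mem_univ _⟩ fun i => mass μ i b')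

/-- `Φ` is invariant under the inverse bit maps (the deterministic bit step at a frozen position). -/
theorem phi_comp_bitEq_symm (μ : St p → ℝ) (β : Bool) : phi (fun x : St p => μ ((bitEq p β).symm x)) = phi μ :=
  phi_shift_eq p μ _ _

end Shift

/-! ## §3 The process on a subcube: laws and their recursion -/

section SubProcess

variable {n : ℕ} (p : ℕ) (y : Fin (n + 1) → (Fin n → Bool) → Bool) (W : Finset (Fin n)) (b : Fin n → Bool)

/-- merged inputs agree with `u` off `W`. -/
theorem merge_apply_free (u : Fin n → Bool) {i : Fin n} (hi : i ∉ W) : subcubeMerge W b u i = u i := by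
  simp [subcubeMerge, hi]

/-- merged inputs agree with `b` on `W`. -/
theorem merge_apply_frozen (u : Fin n → Bool) {i : Fin n} (hi : i ∈ W) : subcubeMerge W b u i = b i := by
  simp [subcubeMerge, hi]

/-- updating a free bit commutes with merging. -/
theorem merge_update_free (u : Fin n → Bool) {i : Fin n} (hi : i ∉ W) (β : Bool) :
    subcubeMerge W b (Function.update u i β) = Function.update (subcubeMerge W b u) i β := by
  funext j
  by_cases hj : j = i
  · subst hj; simp [subcubeMerge, hi]
  · simp [subcubeMerge, Function.update_of_ne hj]

/-- the law of the state before cut `t` over the subcube (each point counted `2^{|W|}` times). -/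
noncomputable def lawS (t : ℕ) (x : St p) : ℝ :=
  ((univ.filter fun u : Fin n → Bool => X p y (subcubeMerge W b u) t = x).card : ℝ)

/-- the law of the state after cut `t` over the subcube. -/
noncomputable def lawSP (t : ℕ) (x : St p) : ℝ :=
  ((univ.filter fun u : Fin n → Bool => Xp p y (subcubeMerge W b u) t = x).card : ℝ)

/-- CharDialCounterSubcubeA helper `lawS_nonneg` (decomp-qadv land package; see the module docstring). -/
theorem lawS_nonneg (t : ℕ) (x : St p) : 0 ≤ lawS p y W b t x := Nat.cast_nonneg _

/-- CharDialCounterSubcubeA helper `lawSP_nonneg` (decomp-qadv land package; see the module docstring). -/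
theorem lawSP_nonneg (t : ℕ) (x : St p) : 0 ≤ lawSP p y W b t x := Nat.cast_nonneg _

/-- fire step: `lawSP t = lawS t ∘ fireMap t`. -/
theorem lawSP_eq (t : ℕ) (x : St p) : lawSP p y W b t x = lawS p y W b t (fireMap p y t x) := by
  unfold lawSP lawS
  congr 2
  ext u
  simp only [mem_filter, mem_univ, true_and, Xp_eq]
  constructor
  · intro h; rw [← h, fireMap_fireMap]
  · intro h; rw [h, fireMap_fireMap]

/-- **free bit step**: at `t ∉ W` the law halves as in `law_succ`. -/
theorem lawS_succ_free (t : Fin n) (ht : t ∉ W) (x : St p) :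
    lawS p y W b (t.val + 1) x
      = (lawSP p y W b t.val (x.1, x.2.1 - 1, x.2.2) + lawSP p y W b t.val (x.1, x.2.1 - 2, x.2.2 - 1)) / 2 := by
  have hm : ∀ u : Fin n → Bool, subcubeMerge W b u t = u t := fun u => merge_apply_free W b u ht
  have hsplit : (univ.filter fun u : Fin n → Bool => X p y (subcubeMerge W b u) (t.val + 1) = x)
      = (univ.filter fun u : Fin n → Bool =>
            u t = false ∧ Xp p y (subcubeMerge W b u) t.val = (bitEq p false).symm x) ∪
        (univ.filter fun u : Fin n → Bool =>
            u t = true ∧ Xp p y (subcubeMerge W b u) t.val = (bitEq p true).symm x) := by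
    ext u
    simp only [mem_filter, mem_univ, true_and, mem_union, X_succ, Equiv.eq_symm_apply, hm]
    cases u t <;> simp
  have hdisj : Disjoint
      (univ.filter fun u : Fin n → Bool => u t = false ∧ Xp p y (subcubeMerge W b u) t.val = (bitEq p false).symm x)
      (univ.filter fun u : Fin n → Bool =>
        u t = true ∧ Xp p y (subcubeMerge W b u) t.val = (bitEq p true).symm x) := by
    rw [disjoint_filter]
    rintro u _ ⟨h1, _⟩ ⟨h2, _⟩
    rw [h1] at h2; exact Bool.false_ne_true h2
  unfold lawS
  rw [hsplit, card_union_of_disjoint hdisj, Nat.cast_add,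
    card_filter_bit_eq_half t false _ (fun u b' => by rw [merge_update_free W b u ht, Xp_update p y _ t b' le_rfl]),
    card_filter_bit_eq_half t true _ (fun u b' => by rw [merge_update_free W b u ht, Xp_update p y _ t b' le_rfl])]
  unfold lawSP
  have h0 : (bitEq p false).symm x = (x.1, x.2.1 - 1, x.2.2) := by
    rw [bitEq_symm_apply]; simp
  have h1 : (bitEq p true).symm x = (x.1, x.2.1 - 2, x.2.2 - 1) := by
    rw [bitEq_symm_apply]; norm_num
  rw [h0, h1]
  ring

/-- **frozen bit step**: at `t ∈ W` the law moves by the bijection `bitEq (b t)`. -/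
theorem lawS_succ_frozen (t : Fin n) (ht : t ∈ W) (x : St p) :
    lawS p y W b (t.val + 1) x = lawSP p y W b t.val ((bitEq p (b t)).symm x) := by
  have hm : ∀ u : Fin n → Bool, subcubeMerge W b u t = b t := fun u => merge_apply_frozen W b u ht
  unfold lawS lawSP
  congr 2
  ext u
  simp only [mem_filter, mem_univ, true_and, X_succ, Equiv.eq_symm_apply, hm]

/-- the initial law is the point mass `2ⁿ·δ_{(0,0,0)}`. -/
theorem lawS_zero (x : St p) : lawS p y W b 0 x = if x = ((false, false), 0, 0) then 2 ^ n else 0 := by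
  unfold lawS
  simp only [X_zero]
  by_cases hx : x = ((false, false), 0, 0)
  · rw [if_pos hx]; subst hx; simp
  · rw [if_neg hx]
    simp [Ne.symm hx]

variable [NeZero p]

/-- total mass `2ⁿ`. -/
theorem sum_lawS (t : ℕ) : ∑ x, lawS p y W b t x = 2 ^ n := by
  unfold lawS
  rw [← Nat.cast_sum, ← card_eq_sum_card_fiberwise (s := univ) (t := univ)
    (fun u _ => mem_univ (X p y (subcubeMerge W b u) t))]
  simp

/-- total mass `2ⁿ`. -/
theorem sum_lawSP (t : ℕ) : ∑ x, lawSP p y W b t x = 2 ^ n := by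
  unfold lawSP
  rw [← Nat.cast_sum, ← card_eq_sum_card_fiberwise (s := univ) (t := univ)
    (fun u _ => mem_univ (Xp p y (subcubeMerge W b u) t))]
  simp

/-- the LOSE count on the subcube as a mass of the final law. -/
theorem card_loseS_eq
    (hy : ∀ g : Fin (n + 1), ∀ u v : Fin n → Bool, wtPrefix u g.val % p = wtPrefix v g.val % p → y g u = y g v)
    (c : ℕ) :
    ((univ.filter fun u : Fin n → Bool => ringWinU c y (subcubeMerge W b u) = false).card : ℝ)
      = ∑ b' : ZMod p, mass (lawSP p y W b n) (((n : ℕ) : ZMod 3) - c, none) b' := by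
  set i₀ : Idx := (((n : ℕ) : ZMod 3) - c, none)
  have h1 : (univ.filter fun u : Fin n → Bool => ringWinU c y (subcubeMerge W b u) = false)
      = univ.filter fun u : Fin n → Bool =>
          mem i₀ (Xp p y (subcubeMerge W b u) n).1 (Xp p y (subcubeMerge W b u) n).2.1 = true := by
    ext u; simp only [mem_filter, mem_univ, true_and, lose_iff p y hy c (subcubeMerge W b u), i₀]
  rw [h1, card_eq_sum_card_fiberwise (t := univ) (f := fun u => Xp p y (subcubeMerge W b u) n) (fun u _ => mem_univ _),
    Nat.cast_sum, sum_St]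
  refine sum_congr rfl fun b' _ => ?_
  unfold mass lawSP
  refine sum_congr rfl fun g _ => sum_congr rfl fun a _ => ?_
  by_cases hmm : mem i₀ g a = true
  · rw [if_pos hmm]
    congr 2; ext u
    simp only [mem_filter, mem_univ, true_and]
    constructor
    · exact fun h => h.2
    · intro h; refine ⟨?_, h⟩; rw [h]; exact hmm
  · rw [if_neg hmm]
    norm_cast
    rw [card_eq_zero, filter_eq_empty_iff]
    rintro u hu h
    simp only [mem_filter, mem_univ, true_and] at hu
    rw [h] at hu; exact hmm hu

/-! ## §4 The `L²` budget over the free steps -/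

/-- fires preserve `Q`. -/
theorem Q_lawSP (t : ℕ) : Q (lawSP p y W b t) = Q (lawS p y W b t) := by
  have h : lawSP p y W b t = fun x =>
      lawS p y W b t (Function.Involutive.toPerm (fireMap p y t) (fireMap_fireMap p y t) x) := by
    funext x; exact lawSP_eq p y W b t x
  rw [h]; exact Q_comp_equiv _ _

omit [NeZero p] in
/-- the free bit step as an average of two reindexed copies. -/
theorem lawS_succ_free' (t : Fin n) (ht : t ∉ W) (x : St p) :
    lawS p y W b (t.val + 1) x
      = (lawSP p y W b t.val ((bitEq p false).symm x) + lawSP p y W b t.val ((bitEq p true).symm x)) / 2 := by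
  rw [lawS_succ_free p y W b t ht, bitEq_symm_apply, bitEq_symm_apply]
  simp only [Bool.toNat_false, Bool.toNat_true, add_zero, Nat.cast_one, Nat.cast_zero, sub_zero, Nat.reduceAdd,
    Nat.cast_ofNat]

/-- parallelogram at a free step. -/
theorem Q_lawS_succ_free (t : Fin n) (ht : t ∉ W) :
    Q (lawS p y W b (t.val + 1)) = Q (lawSP p y W b t.val) - D2 p (lawSP p y W b t.val) / 4 := by
  have h : lawS p y W b (t.val + 1) = fun x =>
      (lawSP p y W b t.val ((bitEq p false).symm x) + lawSP p y W b t.val ((bitEq p true).symm x)) / 2 := by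
    funext x; exact lawS_succ_free' p y W b t ht x
  rw [h, Q_avg, Q_comp_equiv, Q_comp_equiv]
  have hD : ∑ x, (lawSP p y W b t.val ((bitEq p false).symm x) - lawSP p y W b t.val ((bitEq p true).symm x)) ^ 2
      = D2 p (lawSP p y W b t.val) := by
    unfold D2
    rw [← Equiv.sum_comp (bitEq p false)
      (fun x => (lawSP p y W b t.val ((bitEq p false).symm x) - lawSP p y W b t.val ((bitEq p true).symm x)) ^ 2)]
    refine sum_congr rfl fun x _ => ?_
    simp only [Equiv.symm_apply_apply, bitEq_true_symm_bitEq_false]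
  rw [hD]; ring


end SubProcess
end CounterLaw
end Summit.QuantumAdvantage.AdviceFreeQNC0
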